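import Summits.HodgeConjecture.HodgeConjecture.Theses.HolomorphicityRate
import Literature.AlgebraicGeometry.HodgeTheory.HodgeTypeDimension
import HarnessLib

/-!
# Route `HolomorphicityRate`, item `Assembly` (stmt-HodgeConjecture-2744)

The assembly item of route `route-HodgeConjecture-HolomorphicityRate` is the implication

`RateGap → SuperThresholdRigidity → AnalyticSupportAlgebraic → HodgeModelsExist → HodgeConjecture`,

literally the type of the route's deciding theorem
`Summit.HodgeConjecture.HodgeConjecture.Theses.HolomorphicityRate.closes`.  It is pure logic plus
`ℂ`-submodule arithmetic in `H²ᵖ(X(ℂ); ℂ)`: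

* `HodgeModelsExist` discharges the anti-vacuity conjunct `Nonempty (HodgeModel n X)` of
  `HodgeConjectureFor n X`;
* for `p ≤ n` and a rational class `c` of type `(p,p)` — i.e. `A.pullback (2p) c ∈ A.hodgePQ (2p) p p`
  in some Hodge model `A` — `RateGap` (R1) supplies the ray data
  `(g, m ≥ 1, hp ∈ Nᵖ H²ᵖ rational, C, a_k ≤ C·kᵖ, δ > 0, C')` together with super-threshold nearly
  holomorphic supports of `m•c + a_k•hp` for infinitely many `k`; these are syntactically the
  hypotheses of `SuperThresholdRigidity` (R2), which returns one `k` and a closed analytic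
  `S ⊆ X^an` with regular points of codimension `≥ p` off which `m•c + a_k•hp` dies;
  `AnalyticSupportAlgebraic` (Chow/GAGA) makes `m•c + a_k•hp` algebraic, `a_k•hp` is algebraic
  because `Nᵖ H²ᵖ` is a `ℂ`-submodule, so `m•c` and then `c = m⁻¹ • (m•c)` are algebraic;
* for `n < p` the class is `0` (`IsOfHodgeType.eq_zero_pp_of_lt`: no `(p,p)`-classes above the
  dimension), and `0` is algebraic.

The proof is self-contained (it does not invoke `closes`), so it does not depend on the
regeneration of the route file; it is the same argument, recorded against the item's own decl.

## References

* P. Deligne, *The Hodge conjecture*, Clay Mathematics Institute (2000), §1–§2 [Deligne2000].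
* J.-P. Serre, *Géométrie algébrique et géométrie analytique*, Ann. Inst. Fourier 6 (1956)
  [SerreGAGA1956].
-/

-- `Summit.HodgeConjecture.HodgeConjecture.Theorems` is the mandated namespace (single-conjunct summit:
-- Sub = Summit), which `linter.dupNamespace` flags on every declaration; the lakefile turns the
-- linter off tree-wide (weak option), restated here so stand-alone elaboration is warning-free too.
set_option linter.dupNamespace false

namespace Summit.HodgeConjecture.HodgeConjecture.Theorems

open Summit.HodgeConjecture.HodgeConjecture.Theses.HolomorphicityRate
open Literature.AlgebraicGeometry.HodgeTheory

/-- **Assembly of route HolomorphicityRate** (item stmt-HodgeConjecture-2744):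
`RateGap → SuperThresholdRigidity → AnalyticSupportAlgebraic → HodgeModelsExist → HodgeConjecture`.
Given `X` smooth projective of dimension `n`, `HodgeModelsExist` supplies the Hodge-model conjunct of
`HodgeConjectureFor n X`; for a rational `(p,p)`-class `c` with `p ≤ n`, feed the ray data and the
frequently-in-`k` super-threshold supports of `RateGap` into `SuperThresholdRigidity` to get one `k`
with `m•c + a_k•hp` supported off a closed analytic set of codimension `≥ p`, hence algebraic by
`AnalyticSupportAlgebraic`; subtract the algebraic `a_k•hp` and divide by `m ≠ 0`.  For `n < p` the
class vanishes (`IsOfHodgeType.eq_zero_pp_of_lt`).  The type is literally the route decl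
`Summit.HodgeConjecture.HodgeConjecture.Theses.HolomorphicityRate.Assembly` (= the statement of the
route's deciding theorem `closes`). -/
theorem holomorphicityRate_assembly_proof :
    Summit.HodgeConjecture.HodgeConjecture.Theses.HolomorphicityRate.Assembly := by
  unfold Summit.HodgeConjecture.HodgeConjecture.Theses.HolomorphicityRate.Assembly
  intro h₁ h₂ h₃ h₄ n X hX
  refine ⟨h₄ n X hX, fun p c hc hH ↦ ?_⟩
  rcases le_or_gt p n with hp | hp
  · -- `p ≤ n`: run R1 in a model where `c` is `(p,p)`, feed its witnesses to R2, apply Chow/GAGA.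
    obtain ⟨A, hA⟩ := hH
    obtain ⟨g, m, hp', C, a, δ, C', hm, hrat, halg, hbud, hδ, hfreq⟩ := h₁ n p X hX hp A c hc hA
    obtain ⟨k, S, hS, hsupp⟩ := h₂ n p X hX hp A g c hp' m C a δ C' hrat halg hm hbud hδ hfreq
    -- `m•c + a_k•hp` is algebraic (Chow/GAGA glue) …
    have hmem : ((m : ℂ) • c + ((a k : ℕ) : ℂ) • hp') ∈ algebraicClasses X p :=
      h₃ n p X hX A _ S hS hsupp
    -- … so is `a_k•hp` (`Nᵖ H²ᵖ` is a `ℂ`-submodule) …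
    have hb : (((a k : ℕ) : ℂ) • hp') ∈ algebraicClasses X p := Submodule.smul_mem _ _ halg
    -- … hence `m•c`, and `c = m⁻¹ • (m•c)` since `m ≠ 0`.
    have hmc : ((m : ℂ) • c) ∈ algebraicClasses X p := by
      have h := Submodule.sub_mem _ hmem hb
      rwa [add_sub_cancel_right] at h
    have hm0 : (m : ℂ) ≠ 0 := Nat.cast_ne_zero.2 hm.ne'
    have h := Submodule.smul_mem _ ((m : ℂ)⁻¹) hmc
    rwa [smul_smul, inv_mul_cancel₀ hm0, one_smul] at h
  · -- `n < p`: there are no `(p,p)`-classes above the dimension, so `c = 0`.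
    rw [hH.eq_zero_pp_of_lt hp]
    exact Submodule.zero_mem _

end Summit.HodgeConjecture.HodgeConjecture.Theorems
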